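import Summits.QuantumFields.YangMills.Theorems.VirialFluxGapFixSliceLetters
import Summits.QuantumFields.YangMills.Theorems.VirialFluxGapRingChartPhase
import Summits.QuantumFields.YangMills.Theorems.VirialFluxGapRingReferenceZero
import HarnessLib

/-!
# The phase model of `F_fix` ALONG THE SLICE MAP: ✓`ChartPhase.abs_ringDeficit_sub_chartModel_le` read through the Cor-B letters of `fixSlice`
# (item (b) «hf» of the DIRECT Laplace road to ⟨stmt-QuantumFields-24204⟩ `VirialFluxGap.SharpTwistedLaplace`)

Helper module (free-hands work of width seat ym-line-sfw-p2-w2 g50, cell ym-idea-1; `--supports 24204`).  w3 g56's phase model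
✓`ChartPhase.abs_ringDeficit_sub_chartModel_le` expands the twisted ring deficit around a zero `R` in the LEFT product exponential chart with
skew-Hermitian matrix letters `A_{i,e}, B_x` of Frobenius norm `≤ m ≤ 1/4`: `|F_z(P) − (Q(A,B) − C(A,B))| ≤ 6720·L⁴·m⁴` with the explicit quadratic
form `Q` and odd cubic form `C`.  Along w3 g57's slice map `σ = fixSlice ωC ωN ωX C₀ N_s R y` at the base ring `Q_s` the letters are
`A = quatMatrix ∘ sliceLetterA ωN ωX y`, `B = quatMatrix ∘ sliceLetterB ωC y` (✓`coe_ring_fixSlice_link`, ✓`coe_fixSlice_seam`), LINEAR in `y`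
(✓`sliceLetterA_add/smul`), of Frobenius norm `√2·‖coordinate‖` (✓`frob_norm_quatMatrix`).  Hence
★★ `abs_ringDeficit_fixSlice_sub_chartModel_le`: if every slice coordinate has norm `≤ M` with `√2·M ≤ 1/4`, then
`|F_fix(σ(y)) − (Q − C)(quatMatrix∘sliceLetterA y, quatMatrix∘sliceLetterB y)| ≤ 6720·L⁴·(√2 M)⁴ = 26880·L⁴·M⁴` — the model is a quadratic form in
`y` minus an odd cubic form in `y` (parity by linearity of the letters and ✓`ChartPhase.cubicPiece_neg`), i.e. the input of
✓`QuantitativeLaplace.window_phase_data_of_model` (with ✓`inner_sumSq_operator` for the operator of `Q`) for the `hf` datum of the orbit Laplace theorem.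
Everything here is PROVED; no definitions, no named facts (namespace `Summit.QuantumFields.YangMills.Theorems.VirialFluxGap.AnchorSlice`).

HONEST FRAMING: bookkeeping; ⟨24204⟩, ⟨24319⟩, ⟨22884⟩ and every rung stay OPEN; the Yang–Mills mass gap (Clay) is NOT touched; no summit is proved by a line.

## References
* M. Lüscher, Nucl. Phys. B219 (1983), §2. [Luscher1983]
* K. W. Breitung, *Asymptotic Approximations for Probability Integrals*, LNM 1592 (1994), Lemma 7 p. 12. [Breitung1994]
-/

set_option autoImplicit false

noncomputable section

open scoped Quaternion RealInnerProductSpace BigOperators Matrix Matrix.Norms.Frobenius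
open NormedSpace
open Literature.MathematicalPhysics.QuantumFieldTheory hiding SU2 su2Quat_mul
open Literature.MathematicalPhysics.QuantumLattice
open Literature.MathematicalPhysics.QuantumFieldTheory.Balaban1983to89.T4HaarSU2ExpChart
open Summit.QuantumFields.YangMills.Theorems.FemtoTransferGap
open Summit.QuantumFields.YangMills.Theorems.FemtoTransferGap.TT
open Summit.QuantumFields.YangMills.Theorems.FemtoTransferGap.TwoLattice
open Summit.QuantumFields.YangMills.Theorems.FemtoTransferGap.TwoLattice.Flat
open Summit.QuantumFields.YangMills.Theorems.ToronValleyVolume.Lojasiewicz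
open Summit.QuantumFields.YangMills.Theorems.TwistEaterVolume.Quadratic
open Summit.QuantumFields.YangMills.Theorems.VirialFluxGap.RingDeficit
open Summit.QuantumFields.YangMills.Theorems.VirialFluxGap.FixSplit
open Summit.QuantumFields.YangMills.Theorems.VirialFluxGap.ChartPhase (abs_ringDeficit_sub_chartModel_le)
open Summit.QuantumFields.YangMills.Theorems.QuantitativeLaplace (not_treeEdge_wrap)

namespace Summit.QuantumFields.YangMills.Theorems.VirialFluxGap.AnchorSlice

variable {L : ℕ} [NeZero L]

/-- ★★ **The phase model of `F_fix` along the slice map** (✓`ChartPhase.abs_ringDeficit_sub_chartModel_le` with `A = quatMatrix∘sliceLetterA y`,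
`B = quatMatrix∘sliceLetterB y`, base ring `Q_s = (combFlat w_s ; λ·C₀)`, `m = √2·M`): if every slice coordinate has norm `≤ M`, `√2·M ≤ 1/4`, then
`|F_fix(σ(y)) − (Q − C)| ≤ 6720·L⁴·(√2·M)⁴`, where `Q` is the explicit quadratic and `C` the explicit odd cubic form of the letters (transported seam ∕ plaquette
perturbations `X₂, X₃, Y₂, Y₃` passed by their defining identities, as in the source theorem). [cite: Luscher1983, §2] [cite: Breitung1994, Lemma 7 p. 12] -/
theorem abs_ringDeficit_fixSlice_sub_chartModel_le (hL : 2 ≤ L) (z : Fin 3 → Bool) {k₀ : Fin 3} (hk₀ : z k₀ = true)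
    {lam : Site 3 L → SU2} (hlamc : ∀ x, lam x ∈ Subgroup.center SU2) (hlam0 : lam 0 = 1)
    (hlamflip : ∀ (x : Site 3 L) (k : Fin 3), (x k = 0 ∨ x k = -1) → lam (x.shift k) = lam x * centreElem (z k))
    (hlamstay : ∀ (x : Site 3 L) (k : Fin 3), x k ≠ 0 → x k ≠ -1 → lam (x.shift k) = lam x)
    {N₀ C₀ : SU2} (hN : (su2Quat N₀).re = 0) (hC : (su2Quat C₀).re = 0)
    (hNC : (su2Quat N₀).imI * (su2Quat C₀).imI + (su2Quat N₀).imJ * (su2Quat C₀).imJ + (su2Quat N₀).imK * (su2Quat C₀).imK = 0)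
    {ωC ωN ωX : EuclideanSpace ℝ (Fin 3)} (hCω : ‖ωC‖ = 1) (hNω : ‖ωN‖ = 1) (hX : imQuat ωX = imQuat ωC * imQuat ωN)
    (s : Fin 3 → Bool)
    {R : FixRest L ⟨(((fun _ => (-1 : ZMod L)), k₀) : Edge 3 L), not_treeEdge_wrap hL k₀⟩ 0}
    (hR1 : ∀ i, R.1 i = combFlat (fun a => centreElem (s a) * (if z a then N₀ else 1)) i.1.1)
    (hR2 : ∀ j e, R.2.1 j e = combFlat (fun a => centreElem (s a) * (if z a then N₀ else 1)) e)
    (hR3 : ∀ x, R.2.2 x = lam x.1 * C₀)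
    (y : EuclideanSpace ℝ (Fin 3) × RestParam L ⟨(((fun _ => (-1 : ZMod L)), k₀) : Edge 3 L), not_treeEdge_wrap hL k₀⟩ 0)
    {M : ℝ} (hM0 : 0 ≤ M) (hM : Real.sqrt 2 * M ≤ 1 / 4)
    (hy0 : |y.1 0| ≤ M) (hy12 : (y.1 1) ^ 2 + (y.1 2) ^ 2 ≤ M ^ 2) (hy1 : ∀ i, ‖y.2.1 i‖ ≤ M) (hy2 : ∀ j e, ‖y.2.2.1 j e‖ ≤ M)
    (hy3 : ∀ x, ‖y.2.2.2 x‖ ≤ M)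
    (X₂ X₃ : Edge 3 L → Matrix (Fin 2) (Fin 2) ℂ)
    (hX₂ : ∀ e, X₂ e = ((combFlat (fun a => centreElem (s a) * (if z a then N₀ else 1)) e : SU2) : Matrix (Fin 2) (Fin 2) ℂ) *
      quatMatrix (sliceLetterB ωC y (e.1.shift e.2)) * ((combFlat (fun a => centreElem (s a) * (if z a then N₀ else 1)) e : SU2) : Matrix (Fin 2) (Fin 2) ℂ)ᴴ)
    (hX₃ : ∀ e, X₃ e = (((combFlat (fun a => centreElem (s a) * (if z a then N₀ else 1)) e : SU2) : Matrix (Fin 2) (Fin 2) ℂ) *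
        ((lam (e.1.shift e.2) * C₀ : SU2) : Matrix (Fin 2) (Fin 2) ℂ) * ((combFlat (fun a => centreElem (s a) * (if z a then N₀ else 1)) e : SU2) : Matrix (Fin 2) (Fin 2) ℂ)ᴴ) *
        quatMatrix (sliceLetterA ωN ωX y 0 e) *
        (((combFlat (fun a => centreElem (s a) * (if z a then N₀ else 1)) e : SU2) : Matrix (Fin 2) (Fin 2) ℂ) *
          ((lam (e.1.shift e.2) * C₀ : SU2) : Matrix (Fin 2) (Fin 2) ℂ) * ((combFlat (fun a => centreElem (s a) * (if z a then N₀ else 1)) e : SU2) : Matrix (Fin 2) (Fin 2) ℂ)ᴴ)ᴴ)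
    (Y₂ Y₃ : Fin (2 * L - 1 + 1) → Plaquette 3 L → Matrix (Fin 2) (Fin 2) ℂ)
    (hY₂ : ∀ i p, Y₂ i p = ((combFlat (fun a => centreElem (s a) * (if z a then N₀ else 1)) (p.1, p.2.1.1) : SU2) : Matrix (Fin 2) (Fin 2) ℂ) *
        quatMatrix (sliceLetterA ωN ωX y i (p.1.shift p.2.1.1, p.2.1.2)) *
        ((combFlat (fun a => centreElem (s a) * (if z a then N₀ else 1)) (p.1, p.2.1.1) : SU2) : Matrix (Fin 2) (Fin 2) ℂ)ᴴ)
    (hY₃ : ∀ i p, Y₃ i p = (((combFlat (fun a => centreElem (s a) * (if z a then N₀ else 1)) (p.1, p.2.1.1) : SU2) : Matrix (Fin 2) (Fin 2) ℂ) *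
          ((combFlat (fun a => centreElem (s a) * (if z a then N₀ else 1)) (p.1.shift p.2.1.1, p.2.1.2) : SU2) : Matrix (Fin 2) (Fin 2) ℂ) *
          ((combFlat (fun a => centreElem (s a) * (if z a then N₀ else 1)) (p.1.shift p.2.1.2, p.2.1.1) : SU2) : Matrix (Fin 2) (Fin 2) ℂ)ᴴ) *
        quatMatrix (sliceLetterA ωN ωX y i (p.1.shift p.2.1.2, p.2.1.1)) *
        (((combFlat (fun a => centreElem (s a) * (if z a then N₀ else 1)) (p.1, p.2.1.1) : SU2) : Matrix (Fin 2) (Fin 2) ℂ) *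
          ((combFlat (fun a => centreElem (s a) * (if z a then N₀ else 1)) (p.1.shift p.2.1.1, p.2.1.2) : SU2) : Matrix (Fin 2) (Fin 2) ℂ) *
          ((combFlat (fun a => centreElem (s a) * (if z a then N₀ else 1)) (p.1.shift p.2.1.2, p.2.1.1) : SU2) : Matrix (Fin 2) (Fin 2) ℂ)ᴴ)ᴴ) :
    |ringDeficit L z
        ((Fin.cons (glue (fixSlice ωC ωN ωX C₀ (centreElem (s k₀) * N₀) R y).1) (fixSlice ωC ωN ωX C₀ (centreElem (s k₀) * N₀) R y).2.1 :
            Fin (2 * L - 1 + 1) → GaugeConfig 3 L SU2), (fixSlice ωC ωN ωX C₀ (centreElem (s k₀) * N₀) R y).2.2) -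
      (((∑ i : Fin (2 * L - 1), ∑ e : Edge 3 L, ‖quatMatrix (sliceLetterA ωN ωX y i.castSucc e) - quatMatrix (sliceLetterA ωN ωX y i.succ e)‖ ^ 2 / 2) +
          (∑ e : Edge 3 L, ‖quatMatrix (sliceLetterA ωN ωX y (Fin.last (2 * L - 1)) e) + X₂ e - X₃ e - quatMatrix (sliceLetterB ωC y e.1)‖ ^ 2 / 2) +
          ∑ i : Fin (2 * L - 1 + 1), ∑ p : Plaquette 3 L, ‖quatMatrix (sliceLetterA ωN ωX y i (p.1, p.2.1.1)) + Y₂ i p - Y₃ i p -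
            quatMatrix (sliceLetterA ωN ωX y i (p.1, p.2.1.2))‖ ^ 2 / 2) -
        ((∑ i : Fin (2 * L - 1), ∑ e : Edge 3 L,
            -(((quatMatrix (sliceLetterA ωN ωX y i.castSucc e) - quatMatrix (sliceLetterA ωN ωX y i.succ e)) *
              (quatMatrix (sliceLetterA ωN ωX y i.castSucc e) * quatMatrix (sliceLetterA ωN ωX y i.succ e) -
                quatMatrix (sliceLetterA ωN ωX y i.succ e) * quatMatrix (sliceLetterA ωN ωX y i.castSucc e))).trace.re / 2)) +
          (∑ e : Edge 3 L,
            ((quatMatrix (sliceLetterA ωN ωX y (Fin.last (2 * L - 1)) e) + X₂ e - X₃ e - quatMatrix (sliceLetterB ωC y e.1)) *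
              ((quatMatrix (sliceLetterA ωN ωX y (Fin.last (2 * L - 1)) e) * X₂ e - X₂ e * quatMatrix (sliceLetterA ωN ωX y (Fin.last (2 * L - 1)) e)) -
                (quatMatrix (sliceLetterA ωN ωX y (Fin.last (2 * L - 1)) e) * X₃ e - X₃ e * quatMatrix (sliceLetterA ωN ωX y (Fin.last (2 * L - 1)) e)) -
                (quatMatrix (sliceLetterA ωN ωX y (Fin.last (2 * L - 1)) e) * quatMatrix (sliceLetterB ωC y e.1) -
                  quatMatrix (sliceLetterB ωC y e.1) * quatMatrix (sliceLetterA ωN ωX y (Fin.last (2 * L - 1)) e)) - (X₂ e * X₃ e - X₃ e * X₂ e) -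
                (X₂ e * quatMatrix (sliceLetterB ωC y e.1) - quatMatrix (sliceLetterB ωC y e.1) * X₂ e) +
                (X₃ e * quatMatrix (sliceLetterB ωC y e.1) - quatMatrix (sliceLetterB ωC y e.1) * X₃ e))).trace.re / 2) +
          ∑ i : Fin (2 * L - 1 + 1), ∑ p : Plaquette 3 L,
            ((quatMatrix (sliceLetterA ωN ωX y i (p.1, p.2.1.1)) + Y₂ i p - Y₃ i p - quatMatrix (sliceLetterA ωN ωX y i (p.1, p.2.1.2))) *
              ((quatMatrix (sliceLetterA ωN ωX y i (p.1, p.2.1.1)) * Y₂ i p - Y₂ i p * quatMatrix (sliceLetterA ωN ωX y i (p.1, p.2.1.1))) -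
                (quatMatrix (sliceLetterA ωN ωX y i (p.1, p.2.1.1)) * Y₃ i p - Y₃ i p * quatMatrix (sliceLetterA ωN ωX y i (p.1, p.2.1.1))) -
                (quatMatrix (sliceLetterA ωN ωX y i (p.1, p.2.1.1)) * quatMatrix (sliceLetterA ωN ωX y i (p.1, p.2.1.2)) -
                  quatMatrix (sliceLetterA ωN ωX y i (p.1, p.2.1.2)) * quatMatrix (sliceLetterA ωN ωX y i (p.1, p.2.1.1))) -
                (Y₂ i p * Y₃ i p - Y₃ i p * Y₂ i p) -
                (Y₂ i p * quatMatrix (sliceLetterA ωN ωX y i (p.1, p.2.1.2)) - quatMatrix (sliceLetterA ωN ωX y i (p.1, p.2.1.2)) * Y₂ i p) +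
                (Y₃ i p * quatMatrix (sliceLetterA ωN ωX y i (p.1, p.2.1.2)) - quatMatrix (sliceLetterA ωN ωX y i (p.1, p.2.1.2)) * Y₃ i p))).trace.re / 2))| ≤
      6720 * (L : ℝ) ^ 4 * (Real.sqrt 2 * M) ^ 4 := by
  -- the frame
  have hC0 : (imQuat ωC).re = 0 := imQuat_re ωC
  have hN0 : (imQuat ωN).re = 0 := imQuat_re ωN
  have hX1 : ‖ωX‖ = 1 := by rw [← norm_imQuat, hX, norm_mul, norm_imQuat, norm_imQuat, hCω, hNω, mul_one]
  have hNX : ⟪ωN, ωX⟫ = 0 := by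
    rw [← inner_imQuat_imQuat, hX, real_inner_comm]; exact inner_pure_mul_right hC0 hN0
  -- the zero
  have hRz := ringDeficit_reference_eq_zero hL z hlamc hlamflip hlamstay hN hC hNC s
  -- skew-Hermitian letters (`quatMatrix` of an imaginary quaternion)
  have hskew : ∀ q : ℍ, q.re = 0 → (quatMatrix q)ᴴ = -quatMatrix q := fun q hq => by
    rw [← Literature.Geometry.GaugeTheory.quatMatrix_star, Quaternion.star_eq_neg.mpr hq, quatMatrix_neg]
  have hA : ∀ i e, (quatMatrix (sliceLetterA ωN ωX y i e))ᴴ = -quatMatrix (sliceLetterA ωN ωX y i e) := fun i e =>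
    hskew _ (sliceLetterA_re ωN ωX y i e)
  have hB : ∀ x, (quatMatrix (sliceLetterB ωC y x))ᴴ = -quatMatrix (sliceLetterB ωC y x) := fun x => hskew _ (sliceLetterB_re ωC y x)
  -- norms
  have hAm : ∀ i e, ‖quatMatrix (sliceLetterA ωN ωX y i e)‖ ≤ Real.sqrt 2 * M := fun i e => by
    rw [frob_norm_quatMatrix]
    exact mul_le_mul_of_nonneg_left (norm_sliceLetterA_le hNω hX1 hNX y hM0 hy12 hy1 hy2 i e) (Real.sqrt_nonneg 2)
  have hBm : ∀ x, ‖quatMatrix (sliceLetterB ωC y x)‖ ≤ Real.sqrt 2 * M := fun x => by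
    rw [frob_norm_quatMatrix]
    exact mul_le_mul_of_nonneg_left (norm_sliceLetterB_le hCω y hy0 hy3 x) (Real.sqrt_nonneg 2)
  -- the chart identities
  have hP1 := coe_ring_fixSlice_link (ωC := ωC) (ωN := ωN) (ωX := ωX) (C₀ := C₀) hL hk₀ hR1 hR2 y
  have hP2 := coe_fixSlice_seam (ωC := ωC) (ωN := ωN) (ωX := ωX) hlam0 hR3 (centreElem (s k₀) * N₀) y
  exact abs_ringDeficit_sub_chartModel_le z
    (R := (((fun _ => combFlat (fun a => centreElem (s a) * (if z a then N₀ else 1))), fun x => lam x * C₀) :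
      (Fin (2 * L - 1 + 1) → GaugeConfig 3 L SU2) × (Site 3 L → SU2)))
    (P := ((Fin.cons (glue (fixSlice ωC ωN ωX C₀ (centreElem (s k₀) * N₀) R y).1) (fixSlice ωC ωN ωX C₀ (centreElem (s k₀) * N₀) R y).2.1 :
      Fin (2 * L - 1 + 1) → GaugeConfig 3 L SU2), (fixSlice ωC ωN ωX C₀ (centreElem (s k₀) * N₀) R y).2.2))
    hRz (fun i e => quatMatrix (sliceLetterA ωN ωX y i e)) (fun x => quatMatrix (sliceLetterB ωC y x)) hA hB hM hAm hBm hP1 hP2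
    X₂ X₃ hX₂ hX₃ Y₂ Y₃ hY₂ hY₃

end Summit.QuantumFields.YangMills.Theorems.VirialFluxGap.AnchorSlice
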